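import Summits.HodgeConjecture.HodgeConjecture.Theorems.Ring2AbelianAllAndreProductPencilsRows
import Summits.HodgeConjecture.HodgeConjecture.Theorems.Ring2AbelianAllAndreGraded
import Summits.HodgeConjecture.HodgeConjecture.Theorems.Ring2AbelianAllWeilFloor
import HarnessLib

/-!
# Ring 2 · sub-cell AbelianAll (ALL ABELIAN VARIETIES), André axis, part XXXIII-d — LEVELS: the André axis is GRADED BY THE
# DIMENSION `k = d - p` OF THE CYCLES; each level is ONE statement — transport (resp. lift) of MIDDLE-degree classes on compact
# pencils of abelian varieties of relative dimension EXACTLY `2k` — equivalent to all cells `(k + p, p)`, `p ≤ k`, of its level;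
# `HC` for abelian `2k`-folds discharges level `k`; and `HC` in dimension `g` costs `HC_CM` plus the levels `g ≤ k ≤ 2g`
# (so the axis cannot bootstrap: the levels a dimension supplies lie below the levels the next dimension consumes)

HONEST FRAMING (page 1, verbatim): **research route, not a corollary; conditional on HC_CM plus one named
minimal statement.** Cell line: research route conditional on HC_CM; not a corollary; Q11.4-sentence-2 already
refuted in dim ≥ 3. Nothing in this file proves a case of the Hodge conjecture for an abelian variety. `HC_CM`
(`Theses.RankFourFaces.CMAbelianHodge`), `HC_AV` (`Theses.PadicSemiregularLift.HodgeAbelianVarieties`), `HCAtDim`, `HCUpToDim`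
are BINDERS wherever they occur; `h₂₁` = André's Lemme 6.3.1 and `hGT` = Verdier 1976 are NAMED-FACT BINDERS, never facts; the
reduction item `CMToAbelian` (stmt-16267) is NOT closed; the cell's `B_min` of record (N104) is untouched; NO node is born: the
level forms are FILE-LOCAL NOTATIONS (`TransportMidAt[k]`, `LiftMidAt[k]`, `TransportLevel[k]`, `LiftLevel[k]`); nothing is
claimed minimal; 0 `def`, 0 `sorry`, axioms standard.

## What this part does (brief (ii)/(iii): "record each version"; "identify precisely why … does not suffice")

Write `(d, p)` for "compact pencils of abelian `d`-folds, classes of degree `2p`", and call `k = d - p` — the DIMENSION of the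
algebraic cycles on the fibre — the LEVEL of the cell. Every `S`-retract padding (parts XXXII-a, XXXIII-a/b: `(d, p) ↦ (d + r,
p + r)`) preserves the level, and the constant padding by a CM abelian variety of dimension `k - p` carries `(k + p, p)`, `p ≤ k`,
ONTO the middle cell `(2k, k)`. Hence, FACT-FREE:

* §1 `transportLevel_iff_transportMidAt` — **level `k` of (4) IS the single cell `(2k, k)`**: transport out of CM fibres on all
  cells `(k + p, p)`, `p ≤ k` ⟺ `TransportMidAt[k]`, transport of MIDDLE-degree classes on compact pencils of abelian varieties of
  relative dimension EXACTLY `2k`; `liftLevel_iff_liftMidAt` — the same for the lift (L).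
* §2 `cmAnchoredTransport_iff_forall_transportMidAt` — **(4) ⟺ ⋀_{k ≥ 2} TransportMidAt[k]**; `cmFibreAlgebraicLift_iff_forall_liftMidAt`
  — **(L) ⟺ ⋀_{k ≥ 2} LiftMidAt[k]** (part XXXII-b's `(4) ⟺ (4)^mid`, `(L) ⟺ (L)^mid`, regraded level by level; the levels `k ≤ 1`
  are free); `HC_AV_iff_HC_CM_and_forall_transportMidAt` — the cell row, modulo Lemme 6.3.1 alone.
* §3 `transportMidAt_of_hcAtDim` — **`HCAtDim (2k) ⟹ TransportMidAt[k]`** (NO Verdier; part XX-b's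
  `forall_mem_algebraicClasses_of_hcAtDim` and the rational-span reduction of part XVII-b); `liftMidAt_of_hcAtDim_of_verdier` —
  `HCAtDim (2k) ⟹ LiftMidAt[k]` modulo Verdier; `transportMidAt_of_le_one` — levels `0, 1` unconditionally.
* §4 `hcAtDim_of_HC_CM_of_transportMidAt` — **THE GRADED COST: `HC_CM ∧ ⋀_{g ≤ k ≤ 2g} TransportMidAt[k] ⟹ HCAtDim g`**, modulo
  Lemme 6.3.1 (the pencil of Lemme 6.3.1 through a `g`-fold has relative dimension `2g` and the class has codimension `p ≤ g`,
  i.e. level `2g - p ∈ [g, 2g]`; part IV's `hcAtDim_of_HC_CM_of_cmAnchoredTransportAtRelDim` asked ALL degrees at relative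
  dimension `2g`, i.e. also the levels `< g`); `hcUpToDim_of_HC_CM_of_transportMidAt` — `HC_CM ∧ ⋀_{2 ≤ k ≤ 2G} TransportMidAt[k]
  ⟹ HCUpToDim G`.
* §5 (rev 2) `transportMidAt_two_of_refereed_and_residual` — **level `2` from the Weil floor** (refereed facts + two typed obligations +
  the residual node, all binders); `hcUpToDim_of_HC_CM_of_transportMidAt_three` — the graded cost with the levels `3 ≤ k ≤ 2G` only.

READING — WHY THE AXIS CANNOT BOOTSTRAP (brief (iii)). §3 and §4 run in opposite directions with a gap: the Hodge conjecture for
abelian varieties of dimension `≤ 2k` supplies the levels `≤ k` (§3), while dimension `g` CONSUMES the levels `g, …, 2g` (§4). So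
from `HCUpToDim G` the axis returns at most the levels `≤ G/2`, and the first new dimension `G + 1` needs the levels `G + 1, …,
2G + 2`: no level supplied is a level consumed. Concretely, `HC` for abelian varieties of dimension `≤ 3` (a theorem) and `≤ 4`
(Moonen–Zarhin + Markman) give the levels `≤ 1` resp. `≤ 2`, and the abelian FIVEFOLDS would need the levels `5, …, 10`
(middle classes on compact pencils of abelian `10`- to `20`-folds); the first open level is `k = 3` (3-cycles on abelian sixfolds,
the cell `(6, 3)`; parts XXXII-c/e, XXXIII-c). This is the precise form, on this axis, of "`B(A)` for abelian varieties is known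
(Lieberman) but does not suffice": the auxiliary varieties are the `(2k+1)`-fold total spaces, and what is asked of them is graded
by `k`, not by the dimension of the abelian variety one started from. Nothing here is a new candidate; N104 untouched.

Rev 2 (§5, gen 25): **level `2` is supplied by the WEIL FLOOR** — `TransportMidAt[2]` from the REFEREED fourfold inputs (Moonen–Zarhin
1999; Koike 2004, Schoen 1998, Markman 2023), the two typed obligations `LandherrSplitCriterion`, `PolarizedWeilDiscriminantExists` and the
single residual NODE `WeilFourfoldResidual` of seat ab-weil-1's floor (part XXXII-e's inputs; all BINDERS), or from [Moonen–Zarhin,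
Markman 2025 (unrefereed)]; hence `HC_CM ∧ ⋀_{3 ≤ k ≤ 2G} TransportMidAt[k] ⟹ HCUpToDim G` modulo those binders and Lemme 6.3.1 — the
graded cost starts at the level `3`.

References: Andre1996Motifs (§6.3 Lemme 6.3.1 (i)–(iii) p. 31, a) p. 33); Abdulali1994FamiliesAV (Lemma 6.2 p. 1131);
Milne2020HodgeClassesAV (Prop. 1 p. 7); BrosnanFangNiePearlstein2009 (§6 Lemma 48); Fulton1998 (Prop. 1.7, Thm. 6.2 (a));
CharlesSchnell2014Notes (Cor. 11.3.6 p. 494); Verdier1976 (Cor. (5.1)); GrothendieckTopology1969 (§1); Lieberman1968 (Thm. 1);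
MoonenZarhin1999LowDim (Thms. 0.1–0.2); VoisinHodgeII2003 (§10.2.3); Koike2004WeilHodge (Rem. 2.1); Schoen1998HodgeWeilAddendum (§10);
Markman2023GeneralizedKummers (Thm. 1.3); Markman2025SecantWeil (Cor. 1.6.1, unrefereed).
-/

noncomputable section

set_option linter.dupNamespace false

namespace Summit.HodgeConjecture.HodgeConjecture.Ring2.AbelianAll

open CategoryTheory CategoryTheory.Limits AlgebraicGeometry MonoidalCategory CartesianMonoidalCategory
open Literature.AlgebraicGeometry Literature.AlgebraicGeometry.Motives
open Literature.AlgebraicGeometry.HodgeTheory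
open Literature.AlgebraicGeometry.Deligne1982 (cmLocus)
open Literature.AlgebraicGeometry.Milne1999 (IsOfCMType)
open Literature.AlgebraicGeometry.Andre1996 (andre1996_cmAnchoredPencil)
open Summit.HodgeConjecture.HodgeConjecture
open Summit.HodgeConjecture.HodgeConjecture.Theses
open Summit.HodgeConjecture.HodgeConjecture.Ring2.Deform (HC_CM_of_HC_AV)
open Summit.HodgeConjecture.HodgeConjecture.Ring2.ClassTargets (HCAtDim HCUpToDim hcAtDim_of_le_three
  hcAtDim_four_of_weilClassesFourfolds)
open Summit.HodgeConjecture.HodgeConjecture.Ring2.Hypotheses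

variable {𝒳 S : SchemeOver ℂ}

/-! ## §0 The level forms (file-local notations; nothing is defined or asserted) -/

/-- `TransportMidAt[k]` — CM-anchored transport of MIDDLE-degree complex classes on compact pencils of abelian varieties of relative
dimension EXACTLY `2k` (the cell `(2k, k)`; file-local notation). -/
local notation3 (prettyPrint := false) "TransportMidAt[" k "]" =>
  ∀ ⦃𝒳 S : SchemeOver ℂ⦄ (f : 𝒳 ⟶ S), IsCompactAbelianPencil f (2 * k) →
    ∀ (W : complexBetti 𝒳 (2 * k)), ∀ t ∈ cmLocus f (2 * k),
      complexBetti.map (fiberι f t) (2 * k) W ∈ algebraicClasses (fiberOver f t) k →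
      ∀ s : ComplexPoints S, complexBetti.map (fiberι f s) (2 * k) W ∈ algebraicClasses (fiberOver f s) k

/-- `LiftMidAt[k]` — the lift (L) in lattice form for MIDDLE-degree classes at CM points of compact pencils of abelian varieties
of relative dimension EXACTLY `2k` (file-local notation). -/
local notation3 (prettyPrint := false) "LiftMidAt[" k "]" =>
  ∀ ⦃𝒳 S : SchemeOver ℂ⦄ (f : 𝒳 ⟶ S), IsCompactAbelianPencil f (2 * k) →
    ∀ t ∈ cmLocus f (2 * k),
      (algebraicClasses (fiberOver f t) k).comap (complexBetti.map (fiberι f t) (2 * k)).hom ≤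
        algebraicClasses 𝒳 k ⊔ LinearMap.ker (complexBetti.map (fiberι f t) (2 * k)).hom

/-- `TransportLevel[k]` — CM-anchored transport on ALL cells `(k + p, p)`, `p ≤ k`, of level `k` (compact pencils of abelian
`(k + p)`-folds, complex classes of degree `2p`; file-local notation). -/
local notation3 (prettyPrint := false) "TransportLevel[" k "]" =>
  ∀ ⦃d : ℕ⦄ ⦃𝒳 S : SchemeOver ℂ⦄ (f : 𝒳 ⟶ S), IsCompactAbelianPencil f d → ∀ p : ℕ, p + k = d → p ≤ k →
    ∀ (W : complexBetti 𝒳 (2 * p)), ∀ t ∈ cmLocus f d,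
      complexBetti.map (fiberι f t) (2 * p) W ∈ algebraicClasses (fiberOver f t) p →
      ∀ s : ComplexPoints S, complexBetti.map (fiberι f s) (2 * p) W ∈ algebraicClasses (fiberOver f s) p

/-- `LiftLevel[k]` — the lift (L) in lattice form on ALL cells `(k + p, p)`, `p ≤ k`, of level `k` (file-local notation). -/
local notation3 (prettyPrint := false) "LiftLevel[" k "]" =>
  ∀ ⦃d : ℕ⦄ ⦃𝒳 S : SchemeOver ℂ⦄ (f : 𝒳 ⟶ S), IsCompactAbelianPencil f d → ∀ p : ℕ, p + k = d → p ≤ k →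
    ∀ t ∈ cmLocus f d,
      (algebraicClasses (fiberOver f t) p).comap (complexBetti.map (fiberι f t) (2 * p)).hom ≤
        algebraicClasses 𝒳 p ⊔ LinearMap.ker (complexBetti.map (fiberι f t) (2 * p)).hom

/-! ## §1 A level is its middle cell — FACT-FREE (padding within the level) -/

/-- **`TransportMidAt[k] ⟹` transport on every cell `(k + p, p)`, `p ≤ k`** (classwise): for `p = k` this is the hypothesis; for
`p < k` pad by a CM abelian variety `B` of dimension `k - p` — the product pencil `B × 𝒳 ⟶ S` has relative dimension `2k`, the
padded class sits in its middle degree, `t` stays CM — and descend by part XXXII-a. FACT-FREE.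
[cite: Fulton1998, Prop. 1.7 and Thm. 6.2 (a)] [cite: Abdulali1994FamiliesAV, (1.1) (p. 1122)] -/
theorem map_fiberι_mem_of_transportMidAt {k : ℕ} (h : TransportMidAt[k]) {d : ℕ} {f : 𝒳 ⟶ S} (hf : IsCompactAbelianPencil f d)
    {p : ℕ} (hpk : p + k = d) (hp : p ≤ k) (W : complexBetti 𝒳 (2 * p)) {t : ComplexPoints S} (ht : t ∈ cmLocus f d)
    (hW : complexBetti.map (fiberι f t) (2 * p) W ∈ algebraicClasses (fiberOver f t) p) (s : ComplexPoints S) :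
    complexBetti.map (fiberι f s) (2 * p) W ∈ algebraicClasses (fiberOver f s) p := by
  subst hpk
  rcases Nat.eq_or_lt_of_le hp with heq | hlt
  · subst heq
    exact h f ((two_mul p).symm ▸ hf) W t ((two_mul p).symm ▸ ht) hW s
  · obtain ⟨B, hBd, hBcm⟩ := exists_isOfCMType_dim_eq_succ (k - p - 1)
    obtain rfl : k = p + B.dim := by omega
    have hn : B.dim + (p + (p + B.dim)) = 2 * (p + B.dim) := by omega
    exact comap_le_comap_of_snd_comp' hf B (t := t) (s := s) (p := p)
      (fun U hU ↦ h _ (isCompactAbelianPencil_snd_comp_of_eq hf B hn) U t (mem_cmLocus_snd_comp_of_eq f B hBcm hn ht) hU s) hW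

/-- **LEVEL `k` OF (4) IS THE SINGLE CELL `(2k, k)`**: `TransportLevel[k] ⟺ TransportMidAt[k]`. FACT-FREE.
[cite: Fulton1998, Prop. 1.7 and Thm. 6.2 (a)] [cite: Andre1996Motifs, §6.3 a) (p. 33)] -/
theorem transportLevel_iff_transportMidAt (k : ℕ) : TransportLevel[k] ↔ TransportMidAt[k] :=
  ⟨fun h _ _ f hf W t ht hW s ↦ h f hf k (two_mul k).symm le_rfl W t ht hW s,
    fun h _ _ _ _ hf _ hpk hp W _ ht hW s ↦ map_fiberι_mem_of_transportMidAt h hf hpk hp W ht hW s⟩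

/-- **`LiftMidAt[k] ⟹` the lift on every cell `(k + p, p)`, `p ≤ k`** (lattice form; padding by a CM `B` of dimension `k - p`,
part XXXII-a's `comap_le_sup_of_snd_comp`). FACT-FREE. [cite: Fulton1998, Prop. 1.7 and Thm. 6.2 (a)] [cite: Milne2020HodgeClassesAV, Prop. 1 (p. 7)] -/
theorem comap_le_sup_of_liftMidAt {k : ℕ} (h : LiftMidAt[k]) {d : ℕ} {f : 𝒳 ⟶ S} (hf : IsCompactAbelianPencil f d)
    {p : ℕ} (hpk : p + k = d) (hp : p ≤ k) {t : ComplexPoints S} (ht : t ∈ cmLocus f d) :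
    (algebraicClasses (fiberOver f t) p).comap (complexBetti.map (fiberι f t) (2 * p)).hom ≤
      algebraicClasses 𝒳 p ⊔ LinearMap.ker (complexBetti.map (fiberι f t) (2 * p)).hom := by
  subst hpk
  rcases Nat.eq_or_lt_of_le hp with heq | hlt
  · subst heq
    exact h f ((two_mul p).symm ▸ hf) t ((two_mul p).symm ▸ ht)
  · obtain ⟨B, hBd, hBcm⟩ := exists_isOfCMType_dim_eq_succ (k - p - 1)
    obtain rfl : k = p + B.dim := by omega
    have hn : B.dim + (p + (p + B.dim)) = 2 * (p + B.dim) := by omega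
    exact comap_le_sup_of_snd_comp' hf B
      (h _ (isCompactAbelianPencil_snd_comp_of_eq hf B hn) t (mem_cmLocus_snd_comp_of_eq f B hBcm hn ht))

/-- **LEVEL `k` OF (L) IS THE SINGLE CELL `(2k, k)`**: `LiftLevel[k] ⟺ LiftMidAt[k]`. FACT-FREE.
[cite: Fulton1998, Prop. 1.7 and Thm. 6.2 (a)] [cite: Milne2020HodgeClassesAV, Prop. 1 (p. 7)] -/
theorem liftLevel_iff_liftMidAt (k : ℕ) : LiftLevel[k] ↔ LiftMidAt[k] :=
  ⟨fun h _ _ f hf t ht ↦ h f hf k (two_mul k).symm le_rfl t ht,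
    fun h _ _ _ _ hf _ hpk hp _ ht ↦ comap_le_sup_of_liftMidAt h hf hpk hp ht⟩

/-! ## §2 The nodes are the conjunctions of their levels `k ≥ 2` — FACT-FREE -/

/-- **(4) ⟺ ⋀_{k ≥ 2} TransportMidAt[k]** (part XXXII-b's `(4) ⟺ (4)^mid_{≥2}`, regraded: `(4)^mid_{≥2}` is by definition the
conjunction of the exact levels `k ≥ 2`; the levels `0, 1` are free). FACT-FREE. [cite: Andre1996Motifs, §6.3 a) (p. 33)]
[cite: BrosnanFangNiePearlstein2009, §6 Lemma 48] -/
theorem cmAnchoredTransport_iff_forall_transportMidAt : CMAnchoredTransport ↔ ∀ k : ℕ, 2 ≤ k → TransportMidAt[k] := by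
  rw [cmAnchoredTransport_iff_transportMid]
  exact ⟨fun h k hk _ _ f hf W t ht hW s ↦ h f hf hk W t ht hW s, fun h m _ _ f hf hm W t ht hW s ↦ h m hm f hf W t ht hW s⟩

/-- **(L) ⟺ ⋀_{k ≥ 2} LiftMidAt[k]** (part XXXII-b's `(L) ⟺ (L)^mid_{≥2}`, regraded). FACT-FREE.
[cite: Milne2020HodgeClassesAV, Prop. 1 (p. 7)] [cite: BrosnanFangNiePearlstein2009, §6 Lemma 48] -/
theorem cmFibreAlgebraicLift_iff_forall_liftMidAt : CMFibreAlgebraicLift ↔ ∀ k : ℕ, 2 ≤ k → LiftMidAt[k] := by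
  rw [cmFibreAlgebraicLift_iff_liftMid]
  exact ⟨fun h k hk _ _ f hf t ht ↦ h f hf hk t ht, fun h m _ _ f hf hm t ht ↦ h m hm f hf t ht⟩

/-- **The cell row, graded: `HC_AV ⟺ HC_CM ∧ ⋀_{k ≥ 2} TransportMidAt[k]` modulo Lemme 6.3.1 alone.** research route, not a
corollary; conditional on HC_CM plus one named minimal statement. [cite: Andre1996Motifs, Lemme 6.3.1 (p. 31) and §6.3 a) (p. 33)] -/
theorem HC_AV_iff_HC_CM_and_forall_transportMidAt (h₂₁ : andre1996_cmAnchoredPencil) :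
    PadicSemiregularLift.HodgeAbelianVarieties ↔
      RankFourFaces.CMAbelianHodge ∧ ∀ k : ℕ, 2 ≤ k → TransportMidAt[k] := by
  rw [← cmAnchoredTransport_iff_forall_transportMidAt]
  exact HC_AV_iff_HC_CM_and_cmAnchoredTransport h₂₁

/-! ## §3 What `HC` in dimension `2k` supplies: the level `k` -/

/-- **`HCAtDim (2k) ⟹ TransportMidAt[k]` — NO Verdier**: on a compact pencil of abelian `2k`-folds every fibrewise rational `(k,k)`
class is algebraic on every fibre (part XX-b `forall_mem_algebraicClasses_of_hcAtDim`), and a complex class algebraic on one fibre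
lies in the span of such classes modulo the kernel (part XVII-b). [cite: CharlesSchnell2014Notes, Cor. 11.3.6 (p. 494)]
[cite: GrothendieckTopology1969, §1 pp. 299–300] -/
theorem transportMidAt_of_hcAtDim {k : ℕ} (h : HCAtDim (2 * k)) : TransportMidAt[k] := by
  intro 𝒳 S f hf W t _ hW s
  refine (Submodule.span_le (p := (algebraicClasses (fiberOver f s) k).comap
      (complexBetti.map (fiberι f s) (2 * k)).hom)).2 ?_
    (mem_span_rational_of_map_fiberι_mem_algebraicClasses hf (p := k) hW)
  rintro W' ⟨hW', hW't⟩
  exact forall_mem_algebraicClasses_of_hcAtDim h hf W'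
    (fibrewiseHodge_of_isRationalClass_of_mem_algebraicClasses hf (p := k) hW' hW't) s

/-- **`HCAtDim (2k) ⟹ LiftMidAt[k]` modulo Verdier** (part XX-b `comap_le_sup_of_hcAtDim_of_verdier`).
[cite: Verdier1976, Cor. (5.1)] [cite: CharlesSchnell2014Notes, Cor. 11.3.6 (p. 494)] -/
theorem liftMidAt_of_hcAtDim_of_verdier (hGT : Verdier1976_genericLocalTriviality) {k : ℕ} (h : HCAtDim (2 * k)) :
    LiftMidAt[k] :=
  fun _ _ _ hf t _ ↦ comap_le_sup_of_hcAtDim_of_verdier hGT h hf _ t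

/-- **The levels `k ≤ 1` are unconditional** (`HC` for abelian varieties of dimension `≤ 2 ≤ 3` is a theorem of the tree,
`ClassTargets.hcAtDim_of_le_three`). [cite: VoisinHodgeII2003, §10.2.3] -/
theorem transportMidAt_of_le_one {k : ℕ} (hk : k ≤ 1) : TransportMidAt[k] :=
  transportMidAt_of_hcAtDim (hcAtDim_of_le_three (by omega))

/-- **`HCUpToDim G` supplies exactly the levels `k ≤ G/2`**: `(∀ g ≤ G, HCAtDim g) ⟹ TransportMidAt[k]` for `2k ≤ G`. [cite: CharlesSchnell2014Notes, Cor. 11.3.6 (p. 494)] -/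
theorem transportMidAt_of_hcUpToDim {G : ℕ} (h : HCUpToDim G) {k : ℕ} (hk : 2 * k ≤ G) : TransportMidAt[k] :=
  transportMidAt_of_hcAtDim fun A hA ↦ h A (by omega)

/-! ## §4 What `HC` in dimension `g` consumes: the levels `g ≤ k ≤ 2g` — the graded cost of Lemme 6.3.1 -/

/-- **THE GRADED COST: `HC_CM ∧ ⋀_{g ≤ k ≤ 2g} TransportMidAt[k] ⟹ HCAtDim g`, modulo Lemme 6.3.1 (`h₂₁`).** The pencil of
Lemme 6.3.1 through a `g`-fold `A` has relative dimension `2g` ("`X_s` isogène à `A × A`"); a Hodge class `c ∈ H^{2p}(A)` has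
`p ≤ g` (else `H^{2p}(A) = 0`), so the transport consumed is the cell `(2g, p)` of level `2g - p ∈ [g, 2g]`, supplied by
`TransportMidAt[2g - p]` through the padding of §1; `HC_CM` enters only at the CM fibre, an abelian `2g`-fold of CM type
(`Ring2Transport.mem_algebraicClasses_of_cmChart`). Sharpens part IV's `hcAtDim_of_HC_CM_of_cmAnchoredTransportAtRelDim`, which
asked all degrees at relative dimension `2g` (also the levels `< g`). research route, not a corollary; conditional on HC_CM plus
one named minimal statement. [cite: Andre1996Motifs, Lemme 6.3.1 (i)–(iii) (p. 31) and §6.3 a) (p. 33)] [cite: Abdulali1994FamiliesAV, Lemma 6.2 (p. 1131)] -/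
theorem hcAtDim_of_HC_CM_of_transportMidAt (h₂₁ : andre1996_cmAnchoredPencil) (hCM : RankFourFaces.CMAbelianHodge) (g : ℕ)
    (hB : ∀ k : ℕ, g ≤ k → k ≤ 2 * g → TransportMidAt[k]) : HCAtDim g := by
  intro A hAg
  subst hAg
  have hA : IsSmoothProjective A.dim A.X := AbelianVariety.isSmoothProjective_holds
  refine (hodgeConjectureFor_iff_of_isSmoothProjective nonempty_hodgeModel_holds hA).2 fun p c hc hpp ↦ ?_
  rcases Nat.lt_or_ge A.dim p with hlt | hle
  · haveI := subsingleton_complexBetti hA (show 2 * A.dim < 2 * p by omega)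
    rw [Subsingleton.elim c 0]
    exact Submodule.zero_mem _
  obtain ⟨𝒳, S, f, hf, s, t, W, A₁, A₀, e₁, g, q, hW, hq, hgc, ⟨e₀⟩, hA₀⟩ := h₂₁ A hA p c hc hpp
  -- `HC_CM` at the CM fibre `𝒳_t ≅ A₀.X`
  have h₀ : complexBetti.map (fiberι f t) (2 * p) W ∈ algebraicClasses (fiberOver f t) p :=
    Ring2Transport.mem_algebraicClasses_of_cmChart hCM A₀ e₀ (Andre1996.compactPencil_dim_eq_of_iso hf e₀)
      hA₀ (hW t).1 (hW t).2
  -- the cell `(2·dim A, p)` has level `2·dim A - p ∈ [dim A, 2·dim A]`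
  have h₁ : complexBetti.map (fiberι f s) (2 * p) W ∈ algebraicClasses (fiberOver f s) p :=
    map_fiberι_mem_of_transportMidAt (hB (2 * A.dim - p) (by omega) (by omega)) hf (p := p) (by omega) (by omega) W
      (mem_cmLocus_of_compactPencil hf e₀ hA₀) h₀ s
  -- across the chart `e₁ : A₁.X ≅ 𝒳_s` and back along `g : A ⟶ A₁`
  have h₂ : complexBetti.map e₁.hom (2 * p) (complexBetti.map (fiberι f s) (2 * p) W) ∈ algebraicClasses A₁.X p :=
    (mem_algebraicClasses_map_iff_of_iso e₁).2 h₁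
  have h₃ : (q : ℂ) • c ∈ algebraicClasses A.X p := by
    rw [← hgc]
    exact map_mem_algebraicClasses_of_abelianVariety hA A₁ g.hom.hom.hom h₂
  exact (Submodule.smul_mem_iff _ (Rat.cast_ne_zero.2 hq)).1 h₃

/-- **All dimensions up to `G` at once: `HC_CM ∧ ⋀_{2 ≤ k ≤ 2G} TransportMidAt[k] ⟹ HCUpToDim G`** (the levels `k ≤ 1` are free,
§3), modulo Lemme 6.3.1. E.g. `G = 4`: the Hodge conjecture for abelian varieties of dimension `≤ 4` costs, on this axis, `HC_CM`
and the seven levels `2, …, 8` — middle classes on compact pencils of abelian `4`- to `16`-folds. research route, not a corollary;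
conditional on HC_CM plus one named minimal statement. [cite: Andre1996Motifs, Lemme 6.3.1 (p. 31) and §6.3 a) (p. 33)] -/
theorem hcUpToDim_of_HC_CM_of_transportMidAt (h₂₁ : andre1996_cmAnchoredPencil) (hCM : RankFourFaces.CMAbelianHodge) (G : ℕ)
    (hB : ∀ k : ℕ, 2 ≤ k → k ≤ 2 * G → TransportMidAt[k]) : HCUpToDim G := by
  intro A hAG
  refine hcAtDim_of_HC_CM_of_transportMidAt h₂₁ hCM A.dim (fun k hk hk2 ↦ ?_) A rfl
  rcases Nat.lt_or_ge k 2 with hk1 | hk1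
  · exact transportMidAt_of_le_one (by omega)
  · exact hB k hk1 (by omega)

/-- **THE GAP (the axis cannot bootstrap), displayed on one line**: granted Lemme 6.3.1 and `HC_CM`, `HCUpToDim G` together with the
levels `G/2 < k ≤ 2(G+1)` — NONE of which `HCUpToDim G` supplies through §3 — gives `HCUpToDim (G + 1)`. The hypothesis `hnew`
is exactly what is missing; nothing is claimed about it. [cite: Andre1996Motifs, Lemme 6.3.1 (p. 31)] [cite: CharlesSchnell2014Notes, Cor. 11.3.6] -/
theorem hcUpToDim_succ_of_HC_CM_of_hcUpToDim_of_transportMidAt (h₂₁ : andre1996_cmAnchoredPencil)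
    (hCM : RankFourFaces.CMAbelianHodge) (G : ℕ) (hG : HCUpToDim G)
    (hnew : ∀ k : ℕ, G < 2 * k → k ≤ 2 * (G + 1) → TransportMidAt[k]) : HCUpToDim (G + 1) := by
  refine hcUpToDim_of_HC_CM_of_transportMidAt h₂₁ hCM (G + 1) fun k _ hk ↦ ?_
  rcases Nat.lt_or_ge G (2 * k) with hlt | hge
  · exact hnew k hlt hk
  · exact transportMidAt_of_hcUpToDim hG hge

/-- ON-PATH, graded: `HC_AV ⟹ TransportMidAt[k]` for every `k` (through `HCAtDim (2k)`). [cite: CharlesSchnell2014Notes, Cor. 11.3.6 (p. 494)] -/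
theorem transportMidAt_of_HC_AV (h : PadicSemiregularLift.HodgeAbelianVarieties) (k : ℕ) : TransportMidAt[k] :=
  transportMidAt_of_hcAtDim fun A _ ↦ h A

/-! ## §5 (rev 2) Level `2` is supplied by the Weil floor -/

/-- **Level `2` modulo [Moonen–Zarhin 1999, Markman 2025 (unrefereed)]**: the Hodge conjecture for abelian fourfolds (the tree's
`hcAtDim_four_of_weilClassesFourfolds`, both inputs BINDERS) supplies `TransportMidAt[2]`. [cite: MoonenZarhin1999LowDim, Thms. 0.1–0.2]
[cite: Markman2025SecantWeil, Cor. 1.6.1] -/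
theorem transportMidAt_two_of_moonenZarhin_of_markman (h01 : MoonenZarhin1999_codimTwoHodgeClasses_abelianFourfold)
    (hM : Markman2025_weilClasses_algebraic_abelianFourfold) : TransportMidAt[2] :=
  transportMidAt_of_hcAtDim (k := 2) (hcAtDim_four_of_weilClassesFourfolds h01 hM)

/-- **Level `2` from the WEIL FLOOR — REFEREED facts, two typed obligations and the single residual node** (part XXXII-e's inputs;
Markman's unrefereed fourfold statement is DERIVED, `markmanFourfolds_of_refereed_and_residual`): `TransportMidAt[2]`. Every input a
BINDER; nothing asserted. [cite: MoonenZarhin1999LowDim, Thms. 0.1–0.2] [cite: Koike2004WeilHodge, Rem. 2.1]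
[cite: Schoen1998HodgeWeilAddendum, §10] [cite: Markman2023GeneralizedKummers, Thm. 1.3] -/
theorem transportMidAt_two_of_refereed_and_residual (h01 : MoonenZarhin1999_codimTwoHodgeClasses_abelianFourfold)
    (hK : Koike2004_weilClasses_algebraic_hyperbolicSixfold_one) (hS : Schoen1998_weilClasses_algebraic_hyperbolicSixfold_three)
    (hL : LandherrSplitCriterion) (hM23 : Markman2023_weilClasses_algebraic_discOneWeilFourfold) (hE : PolarizedWeilDiscriminantExists)
    (hR : WeilFourfoldResidual) : TransportMidAt[2] :=
  transportMidAt_two_of_moonenZarhin_of_markman h01 (markmanFourfolds_of_refereed_and_residual hK hS hL hM23 hE hR)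

/-- **THE GRADED COST STARTS AT LEVEL `3`**: `HC_CM ∧ ⋀_{3 ≤ k ≤ 2G} TransportMidAt[k] ⟹ HCUpToDim G`, modulo Lemme 6.3.1 and the Weil-floor
binders of `transportMidAt_two_of_refereed_and_residual` (levels `0, 1` free, level `2` the Weil floor). E.g. `G = 5`: the abelian
varieties of dimension `≤ 5` cost `HC_CM` and the levels `3, …, 10`. research route, not a corollary; conditional on HC_CM plus one named
minimal statement. [cite: Andre1996Motifs, Lemme 6.3.1 (p. 31) and §6.3 a) (p. 33)] [cite: MoonenZarhin1999LowDim, Thms. 0.1–0.2] -/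
theorem hcUpToDim_of_HC_CM_of_transportMidAt_three (h₂₁ : andre1996_cmAnchoredPencil) (hCM : RankFourFaces.CMAbelianHodge)
    (h01 : MoonenZarhin1999_codimTwoHodgeClasses_abelianFourfold) (hK : Koike2004_weilClasses_algebraic_hyperbolicSixfold_one)
    (hS : Schoen1998_weilClasses_algebraic_hyperbolicSixfold_three) (hL : LandherrSplitCriterion)
    (hM23 : Markman2023_weilClasses_algebraic_discOneWeilFourfold) (hE : PolarizedWeilDiscriminantExists) (hR : WeilFourfoldResidual)
    (G : ℕ) (hB : ∀ k : ℕ, 3 ≤ k → k ≤ 2 * G → TransportMidAt[k]) : HCUpToDim G := by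
  refine hcUpToDim_of_HC_CM_of_transportMidAt h₂₁ hCM G fun k hk2 hkG ↦ ?_
  rcases Nat.lt_or_ge k 3 with hk3 | hk3
  · obtain rfl : k = 2 := by omega
    exact transportMidAt_two_of_refereed_and_residual h01 hK hS hL hM23 hE hR
  · exact hB k hk3 hkG

end Summit.HodgeConjecture.HodgeConjecture.Ring2.AbelianAll

end
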